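import Mathlib.Data.Fintype.Order
import Summits.ValiantsHypothesis.ValiantsHypothesis.Theorems.LacunarySymmetroidMatrixDescartesCensusTropicalKLaw

/-!
# Route `KPlusLogSqLaw`, crux `TropicalB` — θ-CONCATENATION: the tropical census is SUPERADDITIVE in the number of classes,
# `T(m, K₁ + K₂) ≥ T(m, K₁) + T(m, K₂) + 1`

HONEST FRAMING.  Helper file toward the registered stubs `stub_tropThin` / `stub_tropFat` of
`Cruxes/TropicalB/Lines/birth.lean` (crux `Summit.ValiantsHypothesis.ValiantsHypothesis.Theses.KPlusLogSqLaw.TropicalB`,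
ledger item `stmt-ValiantsHypothesis-19771`, route `KPlusLogSqLaw`; cell `pub-symmetroid`, seat `val-sym-trop-p4` g6,
2026-08-27).  A LOWER-BOUND transfer tool for the tropical census `TropicalCensus.TropRootLawAt m K B` («every
sign-alternating dominant chain of every design of format `(m, K)` has at most `B` breakpoints»); it proves no part of a
stub and asserts nothing about `TropicalB`, `KPlusLogSqLaw`, `WeakLifting`, `MatrixDescartes` or `VP ≠ VNP`.

WHAT IS PROVED.

**`not_tropRootLawAt_add : ¬ TropRootLawAt m K₁ B₁ → ¬ TropRootLawAt m K₂ B₂ → ¬ TropRootLawAt m (K₁ + K₂) (B₁ + B₂ + 2)`**,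
i.e. `T(m, K₁ + K₂) ≥ T(m, K₁) + T(m, K₂) + 1`.  CONSTRUCTION (θ-concatenation on one board): given a chain of design `A`
(classes `Fin K₁`, `n₁` breakpoints, slopes `θ¹₀ < ⋯ < θ¹_{n₁}`) and one of design `B` (classes `Fin K₂`, `n₂` breakpoints),
the GLUED design has classes `Fin (K₁ + K₂)`; an `A`-class keeps exponent, valuations and signs; a `B`-class `l` gets
exponent `d₂ l + D`, valuation `v₂ a b l + t·d₂ l + θ*·D` and sign `±ε₂ a b l` (row `0` flipped if needed), where
`θ* = θ¹_{n₁} + 1`, the shift `t` puts `B`'s chain at slopes `≥ θ* + 1`, and `D = 2mW + 1` with `W` a bound on every column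
contribution `|θ·d − v|` at every chain time.  A column carrying a `B`-class contributes `(θ − t)·d₂ − v₂ + (θ − θ*)·D`: a
penalty `≤ −D` at `A`-times, a bonus `≥ +D` at `B`-times; so the lifted `A`-terms are unique optima at `A`-times (pure
`A`-competitors by `A`-dominance, mixed ones lose `≥ D > 2mW`), the lifted `B`-terms at the shifted `B`-times, and the
junction alternates by the choice of the flip: `n₁ + n₂ + 2` terms.  USE (corollaries in the companion rows file): every
census CELL becomes an all-`K` FLOOR on its row, `T(m, t·K₀) + 1 ≥ t·(T(m, K₀) + 1)` — e.g. the kernel cells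
`T(5,4) ≥ 48`, `T(6,4) ≥ 63` and the static `K = 3` family `T(m,3) ≥ C(m+2,2) − 2` give floors linear in `K` (quadratic in
`m`) at every format, against the iterated-halving ceiling `T(m,K) + 1 ≤ 4^(m−1)·K` (…TropicalBIteratedHalving).
[folklore: concatenation of parametric families along the parameter axis; presearch (corpus + galaxy) located no statement]
-/

set_option linter.dupNamespace false
set_option autoImplicit false

namespace Summit.ValiantsHypothesis.ValiantsHypothesis.Theorems.KPlusLogSqLaw

open Summit.ValiantsHypothesis.ValiantsHypothesis.Theorems.MatrixDescartes.Negative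
open Summit.ValiantsHypothesis.ValiantsHypothesis.Theorems.LacunarySymmetroidMatrixDescartes
open Summit.ValiantsHypothesis.ValiantsHypothesis.Theorems.LacunarySymmetroidMatrixDescartes.TropicalCensus
open scoped BigOperators
open Finset

namespace Concatenation

variable {m : ℕ}

/-! ## 1. Small tools -/

/-- a finite family of integers is bounded in absolute value by a natural number. [folklore] -/
theorem exists_abs_le {ι : Type*} [Finite ι] (f : ι → ℤ) : ∃ W : ℕ, ∀ i, |f i| ≤ (W : ℤ) := by
  obtain ⟨M, hM⟩ := Finite.exists_le fun i => (f i).natAbs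
  exact ⟨M, fun i => by rw [Int.abs_eq_natAbs]; exact_mod_cast hM i⟩

/-- the tropical weight as a sum of column contributions. [folklore] -/
theorem tropWeight_eq_sum' {K : ℕ} (d : Fin K → ℕ) (v : Fin m → Fin m → Fin K → ℤ) (θ : ℤ)
    (p : Equiv.Perm (Fin m) × (Fin m → Fin K)) :
    tropWeight d v θ p = ∑ i, (θ * (d (p.2 i) : ℤ) - v (p.1 i) i (p.2 i)) := by
  unfold tropWeight
  rw [Finset.mul_sum, ← Finset.sum_sub_distrib]

/-- a sum of `m` integers each at most `W` is at most `m·W`. [folklore] -/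
theorem sum_le_card_mul (f : Fin m → ℤ) (W : ℤ) (h : ∀ i, f i ≤ W) : ∑ i, f i ≤ (m : ℤ) * W := by
  calc ∑ i, f i ≤ ∑ _i : Fin m, W := sum_le_sum fun i _ => h i
    _ = (m : ℤ) * W := by simp

/-- a sum of `m` integers each at least `W` is at least `m·W`. [folklore] -/
theorem card_mul_le_sum (f : Fin m → ℤ) (W : ℤ) (h : ∀ i, W ≤ f i) : (m : ℤ) * W ≤ ∑ i, f i := by
  calc (m : ℤ) * W = ∑ _i : Fin m, W := by simp
    _ ≤ ∑ i, f i := sum_le_sum fun i _ => h i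

/-- a sum of `m` integers each at most `W`, one of which is at most `W − X`, is at most `m·W − X`. [folklore] -/
theorem sum_le_card_mul_sub (f : Fin m → ℤ) (W X : ℤ) (h : ∀ i, f i ≤ W) (i₀ : Fin m) (h₀ : f i₀ ≤ W - X) :
    ∑ i, f i ≤ (m : ℤ) * W - X := by
  classical
  have hsplit : ∑ i, f i = ∑ i, (f i + if i = i₀ then X else 0) - X := by
    rw [sum_add_distrib, sum_ite_eq' univ i₀ (fun _ => X), if_pos (mem_univ _)]; ring
  rw [hsplit]
  refine sub_le_sub_right (sum_le_card_mul _ W fun i => ?_) X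
  by_cases hi : i = i₀
  · subst hi; simp; linarith
  · simp [hi, h i]

/-! ## 2. The concatenation theorem -/

/-- **θ-CONCATENATION / SUPERADDITIVITY IN THE NUMBER OF CLASSES.**
`¬ TropRootLawAt m K₁ B₁ → ¬ TropRootLawAt m K₂ B₂ → ¬ TropRootLawAt m (K₁ + K₂) (B₁ + B₂ + 2)`, i.e.
`T(m, K₁ + K₂) ≥ T(m, K₁) + T(m, K₂) + 1`: two designs on the same board with disjoint class sets are glued along the slope
axis (second design's exponents shifted by `D`, valuations by `t·d + θ*·D`, one row sign-flipped if needed), and the two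
chains run one after the other with an alternating junction.  See the module docstring for the estimates. [folklore] -/
theorem not_tropRootLawAt_add {K₁ K₂ B₁ B₂ : ℕ} (h₁ : ¬ TropRootLawAt m K₁ B₁) (h₂ : ¬ TropRootLawAt m K₂ B₂) :
    ¬ TropRootLawAt m (K₁ + K₂) (B₁ + B₂ + 2) := by
  classical
  intro h
  unfold TropRootLawAt at h₁ h₂
  push Not at h₁ h₂
  obtain ⟨d₁, v₁, ε₁, n₁, θ₁, p₁, hε₁, hθ₁, hdom₁, halt₁, hn₁⟩ := h₁
  obtain ⟨d₂, v₂, ε₂, n₂, θ₂, p₂, hε₂, hθ₂, hdom₂, halt₂, hn₂⟩ := h₂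
  rcases Nat.eq_zero_or_pos K₁ with rfl | hK₁
  · exact absurd (tropRootLawAt_zero m B₁ d₁ v₁ ε₁ n₁ θ₁ p₁ hε₁ hθ₁ hdom₁ halt₁) (by omega)
  rcases Nat.eq_zero_or_pos K₂ with rfl | hK₂
  · exact absurd (tropRootLawAt_zero m B₂ d₂ v₂ ε₂ n₂ θ₂ p₂ hε₂ hθ₂ hdom₂ halt₂) (by omega)
  rcases Nat.eq_zero_or_pos m with rfl | hm
  · have h0 : 0 < n₁ := by omega
    have hk := halt₁ ⟨0, h0⟩
    rw [show p₁ (Fin.succ ⟨0, h0⟩) = p₁ (Fin.castSucc ⟨0, h0⟩) from Subsingleton.elim _ _] at hk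
    exact absurd hk (not_lt.mpr (mul_self_nonneg _))
  -- class embeddings `ιA`, `ιB` and retractions `ρ₁`, `ρ₂`
  set ιA : Fin K₁ → Fin (K₁ + K₂) := Fin.castAdd K₂ with hιA
  set ιB : Fin K₂ → Fin (K₁ + K₂) := Fin.natAdd K₁ with hιB
  obtain ⟨ρ₁, hρ₁⟩ : ∃ ρ₁ : Fin (K₁ + K₂) → Fin K₁, ∀ l' : Fin (K₁ + K₂), (l' : ℕ) < K₁ → ((ρ₁ l' : Fin K₁) : ℕ) = l' :=
    ⟨fun l' => if hl : (l' : ℕ) < K₁ then ⟨l', hl⟩ else ⟨0, hK₁⟩, fun l' hl => by simp [hl]⟩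
  obtain ⟨ρ₂, hρ₂⟩ : ∃ ρ₂ : Fin (K₁ + K₂) → Fin K₂, ∀ l' : Fin (K₁ + K₂), ¬ (l' : ℕ) < K₁ → ((ρ₂ l' : Fin K₂) : ℕ) = l' - K₁ :=
    ⟨fun l' => if hl : (l' : ℕ) < K₁ then ⟨0, hK₂⟩ else ⟨l' - K₁, by omega⟩, fun l' hl => by simp [hl]⟩
  have hιAval : ∀ l, ((ιA l : Fin (K₁ + K₂)) : ℕ) = l := fun l => rfl
  have hιBval : ∀ l, ((ιB l : Fin (K₁ + K₂)) : ℕ) = K₁ + l := fun l => rfl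
  have hιAlt : ∀ l, ((ιA l : Fin (K₁ + K₂)) : ℕ) < K₁ := fun l => by rw [hιAval]; exact l.isLt
  have hιBge : ∀ l, ¬ ((ιB l : Fin (K₁ + K₂)) : ℕ) < K₁ := fun l => by rw [hιBval]; omega
  have hριA : ∀ l, ρ₁ (ιA l) = l := fun l => Fin.ext (by rw [hρ₁ _ (hιAlt l), hιAval])
  have hριB : ∀ l, ρ₂ (ιB l) = l := fun l => Fin.ext (by rw [hρ₂ _ (hιBge l), hιBval]; omega)
  have hιρA : ∀ l' : Fin (K₁ + K₂), (l' : ℕ) < K₁ → ιA (ρ₁ l') = l' := fun l' hl => Fin.ext (by rw [hιAval, hρ₁ _ hl])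
  have hιρB : ∀ l' : Fin (K₁ + K₂), ¬ (l' : ℕ) < K₁ → ιB (ρ₂ l') = l' := fun l' hl => Fin.ext (by rw [hιBval, hρ₂ _ hl]; omega)
  -- the junction data: `θ*`, the time shift `t`, the sign flip `u`
  set θs : ℤ := θ₁ (Fin.last n₁) + 1 with hθs
  set t : ℤ := θs + 1 - θ₂ 0 with ht
  set P : ℤ := termSign ε₁ (p₁ (Fin.last n₁)) * termSign ε₂ (p₂ 0) with hP
  set u : ℤ := if P < 0 then 1 else -1 with hu
  have hu1 : u = 1 ∨ u = -1 := by rw [hu]; split_ifs <;> simp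
  have huabs : u.natAbs = 1 := by rcases hu1 with h | h <;> simp [h]
  have hune : u ≠ 0 := by rcases hu1 with h | h <;> simp [h]
  have huu : u * u = 1 := by rcases hu1 with h | h <;> simp [h]
  have hjunction : termSign ε₁ (p₁ (Fin.last n₁)) * (u * termSign ε₂ (p₂ 0)) < 0 := by
    have hne : P ≠ 0 := mul_ne_zero (hdom₁ _).1 (hdom₂ _).1
    rw [show termSign ε₁ (p₁ (Fin.last n₁)) * (u * termSign ε₂ (p₂ 0)) = u * P by rw [hP]; ring, hu]
    split_ifs with hlt
    · linarith only [hlt]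
    · have : 0 < P := lt_of_le_of_ne (not_lt.mp hlt) (Ne.symm hne)
      linarith only [this]
  -- the bound `W` on column contributions at all chain times, and `D`
  obtain ⟨W₁, hW₁⟩ := exists_abs_le fun x : Fin (n₁ + 1) × Fin m × Fin m × Fin K₁ =>
    θ₁ x.1 * (d₁ x.2.2.2 : ℤ) - v₁ x.2.1 x.2.2.1 x.2.2.2
  obtain ⟨W₂, hW₂⟩ := exists_abs_le fun x : Fin (n₂ + 1) × Fin m × Fin m × Fin K₁ =>
    (θ₂ x.1 + t) * (d₁ x.2.2.2 : ℤ) - v₁ x.2.1 x.2.2.1 x.2.2.2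
  obtain ⟨W₃, hW₃⟩ := exists_abs_le fun x : Fin (n₁ + 1) × Fin m × Fin m × Fin K₂ =>
    (θ₁ x.1 - t) * (d₂ x.2.2.2 : ℤ) - v₂ x.2.1 x.2.2.1 x.2.2.2
  obtain ⟨W₄, hW₄⟩ := exists_abs_le fun x : Fin (n₂ + 1) × Fin m × Fin m × Fin K₂ =>
    θ₂ x.1 * (d₂ x.2.2.2 : ℤ) - v₂ x.2.1 x.2.2.1 x.2.2.2
  set W : ℤ := (W₁ : ℤ) + W₂ + W₃ + W₄ with hW
  have hW0 : 0 ≤ W := by rw [hW]; positivity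
  have c₁ : (0 : ℤ) ≤ W₁ := Nat.cast_nonneg W₁
  have c₂ : (0 : ℤ) ≤ W₂ := Nat.cast_nonneg W₂
  have c₃ : (0 : ℤ) ≤ W₃ := Nat.cast_nonneg W₃
  have c₄ : (0 : ℤ) ≤ W₄ := Nat.cast_nonneg W₄
  have hA1 : ∀ k a b l, |θ₁ k * (d₁ l : ℤ) - v₁ a b l| ≤ W := fun k a b l => by
    have := hW₁ (k, a, b, l); simp only at this; rw [hW]; linarith only [this, c₂, c₃, c₄]
  have hA2 : ∀ j a b l, |(θ₂ j + t) * (d₁ l : ℤ) - v₁ a b l| ≤ W := fun j a b l => by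
    have := hW₂ (j, a, b, l); simp only at this; rw [hW]; linarith only [this, c₁, c₃, c₄]
  have hB1 : ∀ k a b l, |(θ₁ k - t) * (d₂ l : ℤ) - v₂ a b l| ≤ W := fun k a b l => by
    have := hW₃ (k, a, b, l); simp only at this; rw [hW]; linarith only [this, c₁, c₂, c₄]
  have hB2 : ∀ j a b l, |θ₂ j * (d₂ l : ℤ) - v₂ a b l| ≤ W := fun j a b l => by
    have := hW₄ (j, a, b, l); simp only at this; rw [hW]; linarith only [this, c₁, c₂, c₃]
  obtain ⟨D, hD⟩ : ∃ D : ℕ, (D : ℤ) = 2 * m * W + 1 := ⟨(2 * m * W + 1).toNat, Int.toNat_of_nonneg (by positivity)⟩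
  have hD0 : (0 : ℤ) ≤ D := by positivity
  -- the glued design
  obtain ⟨dG, hdG⟩ : ∃ dG : Fin (K₁ + K₂) → ℕ,
      ∀ l', dG l' = if (l' : ℕ) < K₁ then d₁ (ρ₁ l') else d₂ (ρ₂ l') + D := ⟨_, fun _ => rfl⟩
  obtain ⟨vG, hvG⟩ : ∃ vG : Fin m → Fin m → Fin (K₁ + K₂) → ℤ, ∀ a b l',
      vG a b l' = if (l' : ℕ) < K₁ then v₁ a b (ρ₁ l') else v₂ a b (ρ₂ l') + t * d₂ (ρ₂ l') + θs * D :=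
    ⟨_, fun _ _ _ => rfl⟩
  obtain ⟨εG, hεG⟩ : ∃ εG : Fin m → Fin m → Fin (K₁ + K₂) → ℤ, ∀ a b l',
      εG a b l' = if (l' : ℕ) < K₁ then ε₁ a b (ρ₁ l') else (if (a : ℕ) = 0 then u else 1) * ε₂ a b (ρ₂ l') :=
    ⟨_, fun _ _ _ => rfl⟩
  -- column contributions of the glued design
  have hcolA : ∀ (τ : ℤ) a b (l' : Fin (K₁ + K₂)), (l' : ℕ) < K₁ →
      τ * (dG l' : ℤ) - vG a b l' = τ * (d₁ (ρ₁ l') : ℤ) - v₁ a b (ρ₁ l') := by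
    intro τ a b l' hl; rw [hdG, hvG, if_pos hl, if_pos hl]
  have hcolB : ∀ (τ : ℤ) a b (l' : Fin (K₁ + K₂)), ¬ (l' : ℕ) < K₁ →
      τ * (dG l' : ℤ) - vG a b l' = ((τ - t) * (d₂ (ρ₂ l') : ℤ) - v₂ a b (ρ₂ l')) + (τ - θs) * D := by
    intro τ a b l' hl; rw [hdG, hvG, if_neg hl, if_neg hl]; push_cast; ring
  -- lifts of terms
  set liftA : Equiv.Perm (Fin m) × (Fin m → Fin K₁) → Equiv.Perm (Fin m) × (Fin m → Fin (K₁ + K₂)) :=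
    fun q => (q.1, fun i => ιA (q.2 i)) with hliftA
  set liftB : Equiv.Perm (Fin m) × (Fin m → Fin K₂) → Equiv.Perm (Fin m) × (Fin m → Fin (K₁ + K₂)) :=
    fun q => (q.1, fun i => ιB (q.2 i)) with hliftB
  -- signs and weights of pure `A`- / pure `B`-terms
  have hsignA : ∀ q : Equiv.Perm (Fin m) × (Fin m → Fin (K₁ + K₂)), (∀ i, ((q.2 i : Fin (K₁ + K₂)) : ℕ) < K₁) →
      termSign εG q = termSign ε₁ (q.1, fun i => ρ₁ (q.2 i)) := by
    intro q hq
    unfold termSign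
    congr 1
    exact prod_congr rfl fun i _ => by rw [hεG, if_pos (hq i)]
  have hprodS : ∀ σ : Equiv.Perm (Fin m), (∏ i, (if ((σ i : Fin m) : ℕ) = 0 then u else 1)) = u := by
    intro σ
    rw [Equiv.prod_comp σ (fun a : Fin m => if ((a : Fin m) : ℕ) = 0 then u else 1)]
    have e : ∀ a : Fin m, (if ((a : Fin m) : ℕ) = 0 then u else 1) = if a = ⟨0, hm⟩ then u else 1 := by
      intro a; congr 1; exact propext ⟨fun h => Fin.ext h, fun h => by rw [h]⟩
    simp_rw [e]
    simp [Finset.prod_ite_eq']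
  have hsignB : ∀ q : Equiv.Perm (Fin m) × (Fin m → Fin (K₁ + K₂)), (∀ i, ¬ ((q.2 i : Fin (K₁ + K₂)) : ℕ) < K₁) →
      termSign εG q = u * termSign ε₂ (q.1, fun i => ρ₂ (q.2 i)) := by
    intro q hq
    unfold termSign
    have e : (∏ i, εG (q.1 i) i (q.2 i)) =
        (∏ i, (if ((q.1 i : Fin m) : ℕ) = 0 then u else 1)) * ∏ i, ε₂ (q.1 i) i (ρ₂ (q.2 i)) := by
      rw [← prod_mul_distrib]
      exact prod_congr rfl fun i _ => by rw [hεG, if_neg (hq i)]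
    rw [e, hprodS]
    simp only
    ring
  have hsign_liftA : ∀ q, termSign εG (liftA q) = termSign ε₁ q := fun q => by
    rw [hsignA (liftA q) (fun i => hιAlt _)]; congr 1; exact Prod.ext rfl (funext fun i => hριA _)
  have hsign_liftB : ∀ q, termSign εG (liftB q) = u * termSign ε₂ q := fun q => by
    rw [hsignB (liftB q) (fun i => hιBge _)]; congr 2; exact Prod.ext rfl (funext fun i => hριB _)
  have hwA : ∀ (τ : ℤ) (q : Equiv.Perm (Fin m) × (Fin m → Fin (K₁ + K₂))),
      (∀ i, ((q.2 i : Fin (K₁ + K₂)) : ℕ) < K₁) →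
      tropWeight dG vG τ q = tropWeight d₁ v₁ τ (q.1, fun i => ρ₁ (q.2 i)) := by
    intro τ q hq
    rw [tropWeight_eq_sum', tropWeight_eq_sum']
    exact sum_congr rfl fun i _ => hcolA τ _ _ _ (hq i)
  have hwB : ∀ (τ : ℤ) (q : Equiv.Perm (Fin m) × (Fin m → Fin (K₁ + K₂))),
      (∀ i, ¬ ((q.2 i : Fin (K₁ + K₂)) : ℕ) < K₁) →
      tropWeight dG vG τ q = tropWeight d₂ v₂ (τ - t) (q.1, fun i => ρ₂ (q.2 i)) + (m : ℤ) * ((τ - θs) * D) := by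
    intro τ q hq
    rw [tropWeight_eq_sum', tropWeight_eq_sum']
    rw [show (m : ℤ) * ((τ - θs) * D) = ∑ _i : Fin m, (τ - θs) * (D : ℤ) by simp, ← sum_add_distrib]
    exact sum_congr rfl fun i _ => hcolB τ _ _ _ (hq i)
  -- `A`-times: the lifted `A`-terms are unique optima
  have hθA_le : ∀ k : Fin (n₁ + 1), θ₁ k - θs ≤ -1 := fun k => by
    have : θ₁ k ≤ θ₁ (Fin.last n₁) := hθ₁.monotone (Fin.le_last k)
    rw [hθs]; linarith only [this]
  have hdomA : ∀ k : Fin (n₁ + 1), IsDominant dG vG εG (θ₁ k) (liftA (p₁ k)) := by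
    intro k
    refine ⟨by rw [hsign_liftA]; exact (hdom₁ k).1, fun q hq hqs => ?_⟩
    by_cases hpure : ∀ i, ((q.2 i : Fin (K₁ + K₂)) : ℕ) < K₁
    · -- a pure A-competitor: A-dominance
      have hw1 : tropWeight dG vG (θ₁ k) (liftA (p₁ k)) = tropWeight d₁ v₁ (θ₁ k) (p₁ k) := by
        rw [hwA _ _ (fun i => hιAlt _)]
        congr 1; exact Prod.ext rfl (funext fun i => hριA _)
      rw [hw1, hwA _ _ hpure]
      refine (hdom₁ k).2 _ (fun hh => hq ?_) (by rw [← hsignA q hpure]; exact hqs)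
      refine Prod.ext (congrArg Prod.fst hh : q.1 = (p₁ k).1) (funext fun i => ?_)
      show q.2 i = ιA ((p₁ k).2 i)
      rw [← congrFun (congrArg Prod.snd hh) i, hιρA _ (hpure i)]
    · -- a mixed competitor: it pays the penalty `D` in some column
      push Not at hpure
      obtain ⟨i₀, hi₀⟩ := hpure
      have hi₀' : ¬ ((q.2 i₀ : Fin (K₁ + K₂)) : ℕ) < K₁ := not_lt.mpr hi₀
      have hup : tropWeight dG vG (θ₁ k) q ≤ (m : ℤ) * W - D := by
        rw [tropWeight_eq_sum']
        refine sum_le_card_mul_sub _ W (D : ℤ) (fun i => ?_) i₀ ?_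
        · by_cases hi : ((q.2 i : Fin (K₁ + K₂)) : ℕ) < K₁
          · rw [hcolA _ _ _ _ hi]; exact (abs_le.mp (hA1 k _ _ _)).2
          · rw [hcolB _ _ _ _ hi]
            have h1 := (abs_le.mp (hB1 k (q.1 i) i (ρ₂ (q.2 i)))).2
            have h2 : (θ₁ k - θs) * (D : ℤ) ≤ 0 := mul_nonpos_of_nonpos_of_nonneg (by linarith only [hθA_le k]) hD0
            linarith only [h1, h2]
        · rw [hcolB _ _ _ _ hi₀']
          have h1 := (abs_le.mp (hB1 k (q.1 i₀) i₀ (ρ₂ (q.2 i₀)))).2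
          have h2 := mul_le_mul_of_nonneg_right (hθA_le k) hD0
          linarith only [h1, h2]
      have hlo : -((m : ℤ) * W) ≤ tropWeight dG vG (θ₁ k) (liftA (p₁ k)) := by
        rw [tropWeight_eq_sum']
        have := card_mul_le_sum (fun i => θ₁ k * (dG ((liftA (p₁ k)).2 i) : ℤ) -
            vG ((liftA (p₁ k)).1 i) i ((liftA (p₁ k)).2 i)) (-W) (fun i => by
          rw [hcolA _ _ _ _ (hιAlt _)]
          exact (abs_le.mp (hA1 k _ _ _)).1)
        linarith only [this]
      linarith only [hup, hlo, hD, hW0]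
  -- `B`-times: the lifted `B`-terms are unique optima
  have hθB_ge : ∀ j : Fin (n₂ + 1), 1 ≤ θ₂ j + t - θs := fun j => by
    have : θ₂ 0 ≤ θ₂ j := hθ₂.monotone (Fin.zero_le _)
    rw [ht]; linarith only [this]
  have hdomB : ∀ j : Fin (n₂ + 1), IsDominant dG vG εG (θ₂ j + t) (liftB (p₂ j)) := by
    intro j
    refine ⟨by rw [hsign_liftB]; exact mul_ne_zero hune (hdom₂ j).1, fun q hq hqs => ?_⟩
    set X : ℤ := (θ₂ j + t - θs) * D with hX
    have hXD : (D : ℤ) ≤ X := by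
      have := mul_le_mul_of_nonneg_right (hθB_ge j) hD0
      rw [hX]; linarith only [this]
    by_cases hpure : ∀ i, ¬ ((q.2 i : Fin (K₁ + K₂)) : ℕ) < K₁
    · -- a pure B-competitor: B-dominance (at the unshifted time `θ₂ j`)
      have hw1 : tropWeight dG vG (θ₂ j + t) (liftB (p₂ j)) =
          tropWeight d₂ v₂ (θ₂ j) (p₂ j) + (m : ℤ) * ((θ₂ j + t - θs) * D) := by
        rw [hwB _ _ (fun i => hιBge _), show θ₂ j + t - t = θ₂ j by ring]
        congr 2; exact Prod.ext rfl (funext fun i => hριB _)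
      rw [hw1, hwB _ _ hpure, show θ₂ j + t - t = θ₂ j by ring]
      have hne : (q.1, fun i => ρ₂ (q.2 i)) ≠ p₂ j := by
        refine fun hh => hq (Prod.ext (congrArg Prod.fst hh : q.1 = (p₂ j).1) (funext fun i => ?_))
        show q.2 i = ιB ((p₂ j).2 i)
        rw [← congrFun (congrArg Prod.snd hh) i, hιρB _ (hpure i)]
      have hpres : termSign ε₂ (q.1, fun i => ρ₂ (q.2 i)) ≠ 0 := fun h0 => by
        apply hqs; rw [hsignB q hpure, h0, mul_zero]
      linarith only [(hdom₂ j).2 _ hne hpres]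
    · -- a mixed competitor: it misses the bonus `X ≥ D` in some column
      push Not at hpure
      obtain ⟨i₀, hi₀⟩ := hpure
      have hup : tropWeight dG vG (θ₂ j + t) q ≤ (m : ℤ) * (W + X) - X := by
        rw [tropWeight_eq_sum']
        refine sum_le_card_mul_sub _ (W + X) X (fun i => ?_) i₀ ?_
        · by_cases hi : ((q.2 i : Fin (K₁ + K₂)) : ℕ) < K₁
          · rw [hcolA _ _ _ _ hi]
            have := (abs_le.mp (hA2 j (q.1 i) i (ρ₁ (q.2 i)))).2
            linarith only [this, hXD, hD0]
          · rw [hcolB _ _ _ _ hi, show θ₂ j + t - t = θ₂ j by ring]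
            have := (abs_le.mp (hB2 j (q.1 i) i (ρ₂ (q.2 i)))).2
            linarith only [this]
        · rw [hcolA _ _ _ _ hi₀]
          have := (abs_le.mp (hA2 j (q.1 i₀) i₀ (ρ₁ (q.2 i₀)))).2
          linarith only [this]
      have hlo : (m : ℤ) * (-W + X) ≤ tropWeight dG vG (θ₂ j + t) (liftB (p₂ j)) := by
        rw [tropWeight_eq_sum']
        refine card_mul_le_sum _ (-W + X) fun i => ?_
        rw [hcolB _ _ _ _ (hιBge _), show θ₂ j + t - t = θ₂ j by ring, hριB]
        have := (abs_le.mp (hB2 j ((p₂ j).1 i) i ((p₂ j).2 i))).1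
        linarith only [this]
      linarith only [hup, hlo, hXD, hD, hW0]
  -- the concatenated chain and its reading on the two parts
  set n : ℕ := n₁ + n₂ + 1 with hn
  obtain ⟨θG, hθG⟩ : ∃ θG : Fin (n + 1) → ℤ, ∀ k, θG k =
      if hk : (k : ℕ) ≤ n₁ then θ₁ ⟨k, Nat.lt_succ_of_le hk⟩
      else θ₂ ⟨(k : ℕ) - (n₁ + 1), by have := k.isLt; omega⟩ + t := ⟨_, fun _ => rfl⟩
  obtain ⟨pG, hpG⟩ : ∃ pG : Fin (n + 1) → Equiv.Perm (Fin m) × (Fin m → Fin (K₁ + K₂)), ∀ k, pG k =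
      if hk : (k : ℕ) ≤ n₁ then liftA (p₁ ⟨k, Nat.lt_succ_of_le hk⟩)
      else liftB (p₂ ⟨(k : ℕ) - (n₁ + 1), by have := k.isLt; omega⟩) := ⟨_, fun _ => rfl⟩
  have hεG1 : ∀ a b l', (εG a b l').natAbs ≤ 1 := by
    intro a b l'
    rw [hεG]
    split_ifs with hl h0
    · exact hε₁ _ _ _
    · rw [Int.natAbs_mul, huabs, one_mul]; exact hε₂ _ _ _
    · rw [one_mul]; exact hε₂ _ _ _
  have hθG_A : ∀ (k : Fin (n + 1)) (k' : Fin (n₁ + 1)), (k : ℕ) = (k' : ℕ) → θG k = θ₁ k' := fun k k' hkk' => by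
    have hk : (k : ℕ) ≤ n₁ := by have := k'.isLt; omega
    rw [hθG, dif_pos hk]; congr 1; exact Fin.ext hkk'
  have hθG_B : ∀ (k : Fin (n + 1)) (j : Fin (n₂ + 1)), (k : ℕ) = n₁ + 1 + j → θG k = θ₂ j + t := fun k j hkj => by
    have hk : ¬ (k : ℕ) ≤ n₁ := by omega
    rw [hθG, dif_neg hk]; congr 2; exact Fin.ext (show (k : ℕ) - (n₁ + 1) = (j : ℕ) by omega)
  have hpG_A : ∀ (k : Fin (n + 1)) (k' : Fin (n₁ + 1)), (k : ℕ) = (k' : ℕ) → pG k = liftA (p₁ k') := fun k k' hkk' => by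
    have hk : (k : ℕ) ≤ n₁ := by have := k'.isLt; omega
    rw [hpG, dif_pos hk]; congr 2; exact Fin.ext hkk'
  have hpG_B : ∀ (k : Fin (n + 1)) (j : Fin (n₂ + 1)), (k : ℕ) = n₁ + 1 + j → pG k = liftB (p₂ j) := fun k j hkj => by
    have hk : ¬ (k : ℕ) ≤ n₁ := by omega
    rw [hpG, dif_neg hk]; congr 2; exact Fin.ext (show (k : ℕ) - (n₁ + 1) = (j : ℕ) by omega)
  have hsplit : ∀ k : Fin (n + 1), (∃ k' : Fin (n₁ + 1), (k : ℕ) = (k' : ℕ)) ∨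
      (∃ j : Fin (n₂ + 1), (k : ℕ) = n₁ + 1 + j) := fun k => by
    by_cases hk : (k : ℕ) ≤ n₁
    · exact Or.inl ⟨⟨k, Nat.lt_succ_of_le hk⟩, rfl⟩
    · exact Or.inr ⟨⟨(k : ℕ) - (n₁ + 1), by have := k.isLt; omega⟩, by
        show (k : ℕ) = n₁ + 1 + ((k : ℕ) - (n₁ + 1)); omega⟩
  have hθGmono : StrictMono θG := fun a b hab => by
    have hab' : (a : ℕ) < (b : ℕ) := hab
    rcases hsplit a with ⟨a', ha'⟩ | ⟨ja, hja⟩ <;> rcases hsplit b with ⟨b', hb'⟩ | ⟨jb, hjb⟩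
    · rw [hθG_A a a' ha', hθG_A b b' hb']
      exact hθ₁ (Fin.mk_lt_mk.mpr (show (a' : ℕ) < b' by omega))
    · rw [hθG_A a a' ha', hθG_B b jb hjb]
      have h1 : θ₁ a' ≤ θ₁ (Fin.last n₁) := hθ₁.monotone (Fin.le_last _)
      have h2 := hθB_ge jb; rw [hθs] at h2; linarith only [h1, h2]
    · exfalso; have := b'.isLt; omega
    · rw [hθG_B a ja hja, hθG_B b jb hjb]
      have : θ₂ ja < θ₂ jb := hθ₂ (Fin.mk_lt_mk.mpr (show (ja : ℕ) < jb by omega))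
      linarith only [this]
  have hdomG : ∀ k, IsDominant dG vG εG (θG k) (pG k) := fun k => by
    rcases hsplit k with ⟨k', hk'⟩ | ⟨j, hj⟩
    · rw [hθG_A k k' hk', hpG_A k k' hk']; exact hdomA _
    · rw [hθG_B k j hj, hpG_B k j hj]; exact hdomB _
  have haltG : ∀ k : Fin n, termSign εG (pG k.castSucc) * termSign εG (pG k.succ) < 0 := fun k => by
    have hkc : ((k.castSucc : Fin (n + 1)) : ℕ) = (k : ℕ) := Fin.val_castSucc k
    have hks : ((k.succ : Fin (n + 1)) : ℕ) = (k : ℕ) + 1 := Fin.val_succ k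
    by_cases h1 : (k : ℕ) + 1 ≤ n₁
    · -- both terms in the A-part
      set k' : Fin n₁ := ⟨k, by omega⟩ with hk'
      rw [hpG_A k.castSucc k'.castSucc (by rw [hkc, Fin.val_castSucc]),
        hpG_A k.succ k'.succ (by rw [hks, Fin.val_succ]), hsign_liftA, hsign_liftA]
      exact halt₁ k'
    · by_cases h0 : (k : ℕ) ≤ n₁
      · -- the junction `k = n₁`
        have hkn : (k : ℕ) = n₁ := by omega
        rw [hpG_A k.castSucc (Fin.last n₁) (by rw [hkc, Fin.val_last, hkn]),
          hpG_B k.succ 0 (by rw [hks, Fin.val_zero, hkn]), hsign_liftA, hsign_liftB]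
        exact hjunction
      · -- both terms in the B-part
        have hj : (k : ℕ) - (n₁ + 1) < n₂ := by have := k.isLt; omega
        set j : Fin n₂ := ⟨(k : ℕ) - (n₁ + 1), hj⟩ with hjdef
        have hjv : (j : ℕ) = (k : ℕ) - (n₁ + 1) := rfl
        rw [hpG_B k.castSucc j.castSucc (by rw [hkc, Fin.val_castSucc, hjv]; omega),
          hpG_B k.succ j.succ (by rw [hks, Fin.val_succ, hjv]; omega), hsign_liftB, hsign_liftB]
        rw [show u * termSign ε₂ (p₂ j.castSucc) * (u * termSign ε₂ (p₂ j.succ)) =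
            termSign ε₂ (p₂ j.castSucc) * termSign ε₂ (p₂ j.succ) * (u * u) by ring, huu, mul_one]
        exact halt₂ j
  have hfinal := h dG vG εG n θG pG hεG1 hθGmono hdomG haltG
  omega

end Concatenation

end Summit.ValiantsHypothesis.ValiantsHypothesis.Theorems.KPlusLogSqLaw
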